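import Literature.MathematicalPhysics.QuantumManyBody.BosonicFloorSymmetrisation
import Mathlib.Analysis.Calculus.ParametricIntegral
import Mathlib.MeasureTheory.Integral.Bochner.Set
import Mathlib.MeasureTheory.Function.L2Space
import Mathlib.MeasureTheory.Function.LocallyIntegrable
import HarnessLib

/-!
# The regularised root of a translation-averaged density: calculus

Topic `Literature/MathematicalPhysics/QuantumManyBody` (generic tools for the zero-momentum
symmetrisation of the tagged torus gas, companion of `BosonicFloorSymmetrisation.lean`, which
does the same for FINITE sums `∑_σ |f ∘ σ|²` over relabellings). Here the density is averaged over a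
COMPACT family of translates, `F(x) = ∫_{t ∈ k} h(x + c(t)) dμ(t)`, and the trial function is the
regularised root `g_ε = √(ε² + F) − ε` of an abstract non-negative `C¹` function `F`.

* `hasFDerivAt_sqrtRegOf`, `contDiff_ofReal_sqrtRegOf`, `norm_fderiv_sqrtRegOf_sq_le`,
  `nnnorm_fderiv_ofReal_sqrtRegOf_sq_le`, `nnnorm_ofReal_sqrtRegOf_sq_le` : the regularised root of
  a non-negative `C¹` function `F`; the abstract **convexity inequality for gradients**: if
  `|DF(x)u|² ≤ 4 F(x) K` then `‖D g_ε(x) u‖² ≤ K` [LiebLoss2001, Thm. 7.8].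
* `sq_integral_mul_le_integral_sq_mul` : Cauchy–Schwarz for integrals, squared form.
* `hasFDerivAt_setIntegral_comp_add`, `contDiff_one_setIntegral_comp_add`,
  `fderiv_setIntegral_comp_add_apply` : differentiation under the integral sign for
  `x ↦ ∫_{t ∈ k} h(x + c t) dμ` (`h` of class `C¹` on a proper space, `k` compact, `c` continuous).
* `sq_fderiv_setIntegral_norm_sq_le` : for `h = ‖f‖²`,
  `|D F(x) u|² ≤ 4 F(x) ∫_{t ∈ k} ‖D f(x + c t) u‖²` (Cauchy–Schwarz), whence
  `nnnorm_fderiv_sqrtAvg_sq_le` : `‖D g_ε(x) u‖₊² ≤ ∫ ‖Df(x + c t) u‖²` in `ℝ≥0∞`.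

Mathlib has differentiation under the integral sign
(`hasFDerivAt_integral_of_dominated_of_fderiv_le`) and Hölder's inequality
(`integral_mul_le_Lp_mul_Lq_of_nonneg`) but not these assembled forms (searched
`parametric_integral`, `contDiff` + `integral`, `sqrt` + `convexity`).

## References

* [LiebLoss2001] E. H. Lieb, M. Loss, *Analysis*, 2nd ed., AMS 2001: Thm. 7.8 (convexity
  inequality for gradients), Thm. 6.17.
-/

noncomputable section

open MeasureTheory Filter Topology Metric
open scoped InnerProductSpace ENNReal NNReal Pointwise

namespace Literature.MathematicalPhysics.QuantumManyBody.BoseGas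

/-! ### The regularised root `√(ε² + F) − ε` of a non-negative function -/

section SqrtRegOf

variable {E : Type*} {F : E → ℝ}

/-- `‖(g_ε(x) : ℂ)‖₊² = ofReal (g_ε(x)²)` for `g_ε = √(ε² + F) − ε`. [folklore] -/
theorem nnnorm_ofReal_sqrtRegOf_sq_eq (F : E → ℝ) (x : E) (ε : ℝ) :
    ((‖((Real.sqrt (ε ^ 2 + F x) - ε : ℝ) : ℂ)‖₊ : ℝ≥0∞)) ^ 2 =
      ENNReal.ofReal ((Real.sqrt (ε ^ 2 + F x) - ε) ^ 2) := by
  rw [Complex.nnnorm_real, coe_nnnorm_pow_two_eq_ofReal, Real.norm_eq_abs, sq_abs]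

/-- `‖(g_ε(x) : ℂ)‖₊² ≤ ofReal (F x)` (from `g_ε² ≤ F`). [folklore] -/
theorem nnnorm_ofReal_sqrtRegOf_sq_le {x : E} (h0 : 0 ≤ F x) {ε : ℝ} (hε : 0 ≤ ε) :
    ((‖((Real.sqrt (ε ^ 2 + F x) - ε : ℝ) : ℂ)‖₊ : ℝ≥0∞)) ^ 2 ≤ ENNReal.ofReal (F x) := by
  rw [nnnorm_ofReal_sqrtRegOf_sq_eq]
  exact ENNReal.ofReal_le_ofReal (sqrtReg_sq_le hε h0)

variable [NormedAddCommGroup E] [NormedSpace ℝ E]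

/-- `g_ε = √(ε² + F) − ε` has derivative `D g_ε(x) = D F(x) / (2√(ε² + F(x)))` (`ε > 0`,
`F(x) ≥ 0`). [folklore] -/
theorem hasFDerivAt_sqrtRegOf {F' : E →L[ℝ] ℝ} {x : E} (hF : HasFDerivAt F F' x) (h0 : 0 ≤ F x)
    {ε : ℝ} (hε : 0 < ε) :
    HasFDerivAt (fun y => Real.sqrt (ε ^ 2 + F y) - ε)
      ((1 / (2 * Real.sqrt (ε ^ 2 + F x))) • F') x := by
  have hpos : ε ^ 2 + F x ≠ 0 := ne_of_gt (by positivity)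
  exact ((hF.const_add (ε ^ 2)).sqrt hpos).sub_const ε

/-- The complexified regularised root `(g_ε : ℂ)` of a non-negative `C¹` function is `C¹`
(`ε > 0`). [folklore] -/
theorem contDiff_ofReal_sqrtRegOf (hF : ContDiff ℝ 1 F) (h0 : ∀ x, 0 ≤ F x) {ε : ℝ} (hε : 0 < ε) :
    ContDiff ℝ 1 (fun y => ((Real.sqrt (ε ^ 2 + F y) - ε : ℝ) : ℂ)) := by
  refine Complex.ofRealCLM.contDiff.comp ?_
  refine ((contDiff_const.add hF).sqrt fun y => ?_).sub contDiff_const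
  have := h0 y
  positivity

/-- **Convexity inequality for gradients, abstract form**: if `|D F(x) u|² ≤ 4 F(x) K` with
`K ≥ 0`, then `‖D(√(ε² + F) − ε)(x) u‖² = |DF(x)u|² / (4(ε² + F(x))) ≤ K`.
[cite: LiebLoss2001, Thm. 7.8] -/
theorem norm_fderiv_sqrtRegOf_sq_le {F' : E →L[ℝ] ℝ} {x : E} (hF : HasFDerivAt F F' x)
    (h0 : 0 ≤ F x) {ε : ℝ} (hε : 0 < ε) {u : E} {K : ℝ} (hK0 : 0 ≤ K)
    (hK : (F' u) ^ 2 ≤ 4 * F x * K) :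
    ‖fderiv ℝ (fun y => Real.sqrt (ε ^ 2 + F y) - ε) x u‖ ^ 2 ≤ K := by
  rw [(hasFDerivAt_sqrtRegOf hF h0 hε).fderiv, _root_.smul_apply, smul_eq_mul,
    norm_mul, mul_pow, Real.norm_eq_abs, Real.norm_eq_abs, sq_abs, sq_abs, div_pow, one_pow,
    mul_pow, Real.sq_sqrt (by positivity), one_div, inv_mul_le_iff₀ (by positivity)]
  nlinarith [hK, mul_nonneg hK0 (sq_nonneg ε)]

/-- The convexity inequality for the complexified `(g_ε : ℂ)`, in `ℝ≥0∞`: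
`‖D(↑g_ε)(x) u‖₊² ≤ ofReal K` whenever `|DF(x)u|² ≤ 4 F(x) K`. [cite: LiebLoss2001, Thm. 7.8] -/
theorem nnnorm_fderiv_ofReal_sqrtRegOf_sq_le {F' : E →L[ℝ] ℝ} {x : E} (hF : HasFDerivAt F F' x)
    (h0 : 0 ≤ F x) {ε : ℝ} (hε : 0 < ε) {u : E} {K : ℝ} (hK0 : 0 ≤ K)
    (hK : (F' u) ^ 2 ≤ 4 * F x * K) :
    ((‖fderiv ℝ (fun y => ((Real.sqrt (ε ^ 2 + F y) - ε : ℝ) : ℂ)) x u‖₊ : ℝ≥0∞)) ^ 2 ≤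
      ENNReal.ofReal K := by
  have hg := hasFDerivAt_sqrtRegOf hF h0 hε
  have hcomp : (fun y => ((Real.sqrt (ε ^ 2 + F y) - ε : ℝ) : ℂ)) =
      Complex.ofRealCLM ∘ fun y => Real.sqrt (ε ^ 2 + F y) - ε := rfl
  rw [hcomp, (Complex.ofRealCLM.hasFDerivAt.comp x hg).fderiv, ContinuousLinearMap.comp_apply,
    Complex.ofRealCLM_apply, Complex.nnnorm_real, ← hg.fderiv, coe_nnnorm_pow_two_eq_ofReal]
  exact ENNReal.ofReal_le_ofReal (norm_fderiv_sqrtRegOf_sq_le hF h0 hε hK0 hK)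

end SqrtRegOf

/-! ### Cauchy–Schwarz for integrals -/

/-- **Cauchy–Schwarz**, squared form: `(∫ f g)² ≤ (∫ f²)(∫ g²)` for non-negative `f, g ∈ L²`.
[folklore] -/
theorem sq_integral_mul_le_integral_sq_mul {α : Type*} {m : MeasurableSpace α} {μ : Measure α}
    {f g : α → ℝ} (hf0 : 0 ≤ᵐ[μ] f) (hg0 : 0 ≤ᵐ[μ] g) (hf : MemLp f 2 μ) (hg : MemLp g 2 μ) :
    (∫ a, f a * g a ∂μ) ^ 2 ≤ (∫ a, f a ^ 2 ∂μ) * ∫ a, g a ^ 2 ∂μ := by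
  have h := integral_mul_le_Lp_mul_Lq_of_nonneg Real.HolderConjugate.two_two hf0 hg0
    (by rwa [ENNReal.ofReal_ofNat]) (by rwa [ENNReal.ofReal_ofNat])
  simp only [Real.rpow_two] at h
  have hA : 0 ≤ ∫ a, f a ^ 2 ∂μ := integral_nonneg fun a => sq_nonneg _
  have hB : 0 ≤ ∫ a, g a ^ 2 ∂μ := integral_nonneg fun a => sq_nonneg _
  have hI : 0 ≤ ∫ a, f a * g a ∂μ :=
    integral_nonneg_of_ae (by filter_upwards [hf0, hg0] with a ha hb using mul_nonneg ha hb)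
  calc (∫ a, f a * g a ∂μ) ^ 2
      ≤ ((∫ a, f a ^ 2 ∂μ) ^ (1 / 2 : ℝ) * (∫ a, g a ^ 2 ∂μ) ^ (1 / 2 : ℝ)) ^ 2 :=
        pow_le_pow_left₀ hI h 2
    _ = (∫ a, f a ^ 2 ∂μ) * ∫ a, g a ^ 2 ∂μ := by
        rw [mul_pow, ← Real.rpow_natCast ((∫ a, f a ^ 2 ∂μ) ^ (1 / 2 : ℝ)),
          ← Real.rpow_natCast ((∫ a, g a ^ 2 ∂μ) ^ (1 / 2 : ℝ)), ← Real.rpow_mul hA,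
          ← Real.rpow_mul hB]
        norm_num

/-! ### Differentiation under the integral over a compact family of translates -/

section TransInt

variable {H : Type*} [NormedAddCommGroup H] {G : Type*} [NormedAddCommGroup G]
  {β : Type*} [TopologicalSpace β] [MeasurableSpace β] [OpensMeasurableSpace β] [T2Space β]
  {μ : Measure β} [IsLocallyFiniteMeasure μ] {h : H → G} {c : β → H} {k : Set β}

/-- A continuous function of `x + c t` is integrable in `t` over a compact set. [folklore] -/
theorem integrableOn_comp_add_of_continuous {φ : H → G} (hφ : Continuous φ) (hc : Continuous c)
    (hk : IsCompact k) (x : H) : IntegrableOn (fun t => φ (x + c t)) k μ :=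
  (hφ.comp (continuous_const.add hc)).continuousOn.integrableOn_compact hk

/-- A continuous real function of `x + c t` is in `L²(k)` for compact `k`. [folklore] -/
theorem memLp_two_comp_add_of_continuous {φ : H → ℝ} (hφ : Continuous φ) (hc : Continuous c)
    (hk : IsCompact k) (x : H) : MemLp (fun t => φ (x + c t)) 2 (μ.restrict k) :=
  (memLp_two_iff_integrable_sq (hφ.comp (continuous_const.add hc)).aestronglyMeasurable).2
    (integrableOn_comp_add_of_continuous (hφ.pow 2) hc hk x)

variable [NormedSpace ℝ H] [ProperSpace H] [NormedSpace ℝ G] [SecondCountableTopology β]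

/-- **Differentiation under the integral sign for translates.** For `h` of class `C¹` on a proper
space, `c` continuous and `k` compact,
`D(x ↦ ∫_{t∈k} h(x + c t) dμ)(x₀) = ∫_{t∈k} Dh(x₀ + c t) dμ` (domination by the maximum of `‖Dh‖`
on the compact set `B̄(x₀, 1) + c(k)`). [folklore] -/
theorem hasFDerivAt_setIntegral_comp_add (hh : ContDiff ℝ 1 h) (hc : Continuous c)
    (hk : IsCompact k) (x₀ : H) :
    HasFDerivAt (fun x => ∫ t in k, h (x + c t) ∂μ) (∫ t in k, fderiv ℝ h (x₀ + c t) ∂μ) x₀ := by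
  have hd : Differentiable ℝ h := hh.differentiable one_ne_zero
  have hcont : Continuous (fderiv ℝ h) := hh.continuous_fderiv one_ne_zero
  have hK : IsCompact (closedBall x₀ 1 + c '' k) := (isCompact_closedBall x₀ 1).add (hk.image hc)
  obtain ⟨C, hC⟩ := hK.exists_bound_of_continuousOn hcont.continuousOn
  haveI : IsFiniteMeasure (μ.restrict k) := ⟨by
    rw [Measure.restrict_apply_univ]
    exact hk.measure_lt_top⟩
  refine hasFDerivAt_integral_of_dominated_of_fderiv_le (𝕜 := ℝ) (μ := μ.restrict k)
    (F := fun x t => h (x + c t)) (F' := fun x t => fderiv ℝ h (x + c t)) (bound := fun _ => C)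
    (ball_mem_nhds x₀ one_pos) ?_ ?_ ?_ ?_ (integrable_const C) ?_
  · exact Eventually.of_forall fun x =>
      (hh.continuous.comp (continuous_const.add hc)).aestronglyMeasurable
  · exact integrableOn_comp_add_of_continuous hh.continuous hc hk x₀
  · exact (hcont.comp (continuous_const.add hc)).aestronglyMeasurable
  · refine (ae_restrict_iff' hk.measurableSet).2 (ae_of_all _ fun t ht x hx => hC _ ?_)
    exact Set.add_mem_add (ball_subset_closedBall hx) (Set.mem_image_of_mem c ht)
  · exact ae_of_all _ fun t x _ => (hasFDerivAt_comp_add_right (c t)).2 (hd (x + c t)).hasFDerivAt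

/-- `x ↦ ∫_{t∈k} h(x + c t) dμ` is `C¹` for `C¹` `h`, continuous `c`, compact `k`. [folklore] -/
theorem contDiff_one_setIntegral_comp_add (hh : ContDiff ℝ 1 h) (hc : Continuous c)
    (hk : IsCompact k) : ContDiff ℝ 1 (fun x => ∫ t in k, h (x + c t) ∂μ) := by
  have hD := fun x => hasFDerivAt_setIntegral_comp_add (μ := μ) hh hc hk x
  rw [contDiff_one_iff_fderiv]
  refine ⟨fun x => (hD x).differentiableAt, ?_⟩
  have hfd : fderiv ℝ (fun x => ∫ t in k, h (x + c t) ∂μ) =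
      fun x => ∫ t in k, fderiv ℝ h (x + c t) ∂μ := funext fun x => (hD x).fderiv
  rw [hfd]
  exact continuous_parametric_integral_of_continuous (f := fun x t => fderiv ℝ h (x + c t))
    ((hh.continuous_fderiv one_ne_zero).comp (continuous_fst.add (hc.comp continuous_snd))) hk

/-- The derivative under the integral sign, applied to a direction:
`D(∫_{t∈k} h(· + c t))(x) u = ∫_{t∈k} Dh(x + c t) u dμ`. [folklore] -/
theorem fderiv_setIntegral_comp_add_apply (hh : ContDiff ℝ 1 h) (hc : Continuous c)
    (hk : IsCompact k) (x u : H) :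
    fderiv ℝ (fun x => ∫ t in k, h (x + c t) ∂μ) x u = ∫ t in k, fderiv ℝ h (x + c t) u ∂μ := by
  rw [(hasFDerivAt_setIntegral_comp_add hh hc hk x).fderiv]
  exact ContinuousLinearMap.integral_apply
    (integrableOn_comp_add_of_continuous (hh.continuous_fderiv one_ne_zero) hc hk x) u

variable {W : Type*} [NormedAddCommGroup W] [InnerProductSpace ℝ W]

/-- **Gradient of an averaged density, Cauchy–Schwarz.** For `f` of class `C¹` with values in a
real inner product space and `F(x) = ∫_{t∈k} ‖f(x + c t)‖² dμ`:
`|DF(x)u|² ≤ 4 F(x) ∫_{t∈k} ‖Df(x + c t) u‖² dμ` (`D‖f‖² u = 2⟨f, Df u⟩`, then Cauchy–Schwarz in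
`t`). [cite: LiebLoss2001, Thm. 7.8] -/
theorem sq_fderiv_setIntegral_norm_sq_le {f : H → W} (hf : ContDiff ℝ 1 f) (hc : Continuous c)
    (hk : IsCompact k) (x u : H) :
    (fderiv ℝ (fun x => ∫ t in k, ‖f (x + c t)‖ ^ 2 ∂μ) x u) ^ 2 ≤
      4 * (∫ t in k, ‖f (x + c t)‖ ^ 2 ∂μ) * ∫ t in k, ‖fderiv ℝ f (x + c t) u‖ ^ 2 ∂μ := by
  have hd : Differentiable ℝ f := hf.differentiable one_ne_zero
  rw [fderiv_setIntegral_comp_add_apply (hf.norm_sq ℝ) hc hk]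
  have hderiv : ∀ y, fderiv ℝ (fun y => ‖f y‖ ^ 2) y u = 2 * ⟪f y, fderiv ℝ f y u⟫_ℝ := fun y => by
    rw [show (fun y => ‖f y‖ ^ 2) = (‖f ·‖ ^ 2) from rfl, (hd y).hasFDerivAt.norm_sq.fderiv]
    simp only [_root_.smul_apply, ContinuousLinearMap.comp_apply, innerSL_apply_apply,
      nsmul_eq_mul, Nat.cast_ofNat]
  simp only [hderiv]
  -- `|∫ 2⟨f, Df u⟩| ≤ 2 ∫ ‖f‖ ‖Df u‖`
  have hle : ‖∫ t in k, 2 * ⟪f (x + c t), fderiv ℝ f (x + c t) u⟫_ℝ ∂μ‖ ≤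
      2 * ∫ t in k, ‖f (x + c t)‖ * ‖fderiv ℝ f (x + c t) u‖ ∂μ := by
    rw [← integral_const_mul]
    refine norm_integral_le_of_norm_le ((integrableOn_comp_add_of_continuous
      ((hf.continuous.norm).mul ((hf.continuous_fderiv one_ne_zero).clm_apply
        continuous_const).norm) hc hk x).const_mul 2) (ae_of_all _ fun t => ?_)
    rw [norm_mul, Real.norm_ofNat]
    exact mul_le_mul_of_nonneg_left (abs_real_inner_le_norm _ _) zero_le_two
  have hCS := sq_integral_mul_le_integral_sq_mul (μ := μ.restrict k)
    (ae_of_all _ fun t => norm_nonneg (f (x + c t)))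
    (ae_of_all _ fun t => norm_nonneg (fderiv ℝ f (x + c t) u))
    (memLp_two_comp_add_of_continuous hf.continuous.norm hc hk x)
    (memLp_two_comp_add_of_continuous
      ((hf.continuous_fderiv one_ne_zero).clm_apply continuous_const).norm hc hk x)
  calc (∫ t in k, 2 * ⟪f (x + c t), fderiv ℝ f (x + c t) u⟫_ℝ ∂μ) ^ 2
      = ‖∫ t in k, 2 * ⟪f (x + c t), fderiv ℝ f (x + c t) u⟫_ℝ ∂μ‖ ^ 2 := by
        rw [Real.norm_eq_abs, sq_abs]
    _ ≤ (2 * ∫ t in k, ‖f (x + c t)‖ * ‖fderiv ℝ f (x + c t) u‖ ∂μ) ^ 2 :=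
        pow_le_pow_left₀ (norm_nonneg _) hle 2
    _ = 4 * (∫ t in k, ‖f (x + c t)‖ * ‖fderiv ℝ f (x + c t) u‖ ∂μ) ^ 2 := by ring
    _ ≤ 4 * ((∫ t in k, ‖f (x + c t)‖ ^ 2 ∂μ) * ∫ t in k, ‖fderiv ℝ f (x + c t) u‖ ^ 2 ∂μ) :=
        mul_le_mul_of_nonneg_left hCS (by norm_num)
    _ = _ := by ring

/-- **The regularised root of an averaged density obeys the convexity inequality for gradients**:
with `F(x) = ∫_{t∈k} ‖f(x + c t)‖² dμ` and `g_ε = √(ε² + F) − ε` (`ε > 0`),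
`‖D(↑g_ε)(x) u‖₊² ≤ ofReal (∫_{t∈k} ‖Df(x + c t) u‖² dμ)`. [cite: LiebLoss2001, Thm. 7.8] -/
theorem nnnorm_fderiv_sqrtAvg_sq_le {f : H → W} (hf : ContDiff ℝ 1 f) (hc : Continuous c)
    (hk : IsCompact k) {ε : ℝ} (hε : 0 < ε) (x u : H) :
    ((‖fderiv ℝ (fun y => ((Real.sqrt (ε ^ 2 + ∫ t in k, ‖f (y + c t)‖ ^ 2 ∂μ) - ε : ℝ) : ℂ))
        x u‖₊ : ℝ≥0∞)) ^ 2 ≤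
      ENNReal.ofReal (∫ t in k, ‖fderiv ℝ f (x + c t) u‖ ^ 2 ∂μ) :=
  nnnorm_fderiv_ofReal_sqrtRegOf_sq_le
    (hasFDerivAt_setIntegral_comp_add (hf.norm_sq ℝ) hc hk x)
    (integral_nonneg fun t => sq_nonneg _) hε (integral_nonneg fun t => sq_nonneg _)
    (by
      rw [← (hasFDerivAt_setIntegral_comp_add (hf.norm_sq ℝ) hc hk x).fderiv]
      exact sq_fderiv_setIntegral_norm_sq_le hf hc hk x u)

/-- The averaged density of a `C¹` function is `C¹`, and so is its complexified regularised
root `(g_ε : ℂ)` (`ε > 0`). [folklore] -/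
theorem contDiff_ofReal_sqrtAvg {f : H → W} (hf : ContDiff ℝ 1 f) (hc : Continuous c)
    (hk : IsCompact k) {ε : ℝ} (hε : 0 < ε) :
    ContDiff ℝ 1 (fun y =>
      ((Real.sqrt (ε ^ 2 + ∫ t in k, ‖f (y + c t)‖ ^ 2 ∂μ) - ε : ℝ) : ℂ)) :=
  contDiff_ofReal_sqrtRegOf (contDiff_one_setIntegral_comp_add (hf.norm_sq ℝ) hc hk)
    (fun _ => integral_nonneg fun _ => sq_nonneg _) hε

end TransInt

end Literature.MathematicalPhysics.QuantumManyBody.BoseGas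

end
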